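import Literature.ComputerArithmetic.Shewchuk1997.Compress
import Mathlib.Tactic.Linarith
import Mathlib.Tactic.Positivity
import Mathlib.Tactic.Ring
import Mathlib.Tactic.NormNum

/-!
# The last two components of COMPRESS(e) satisfy the roundoff condition (new work)

NEW WORK in the sense of this development (the routine is Shewchuk's COMPRESS, §2.7 of
[Shewchuk1997]; the statement and its proof are ours).  Write `h = COMPRESS(e)` with largest
component `L` and the component `r` just below it.  For every precision `p ≥ 2`, EVERY
round-to-nearest `fl` (no tie rule needed) and every nonoverlapping input expansion of floats
(gradual underflow included), `compress_penultimate_near` proves the ROUNDOFF CONDITION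

* `|r| ≤ ulp(L)/2`, and
* `|r| ≤ ulp(L)/4` whenever `|L| = 2^j` is a power of two with `j ≥ emin + p` and `r` points
  towards zero from `L` (`|L + r| < |L|`),

i.e. exactly the hypothesis `hnear` of `roundExpansion_eq_fl_sum`
(`Summits/Ventures/CertifiedArithmetic/Expansions/RoundExpansion.lean`): together with Theorem 23
(`compress_spec`: the output is a nonoverlapping expansion of floats, with no zero component unless
it is the single component `[Σ e]`) it makes ROUND-EXPANSION ∘ COMPRESS return the correctly
rounded sum `fl (Σ e)`.  Theorem 23 itself only says that `L` is within `ulp(L)` of `Σ h`; it puts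
no constraint on `r` beyond nonoverlap (`|r| < ulp(L)` in effect), and the components below `L`
can sum to more than `ulp(L)/2` (`|Σ h − L| = 17/32·ulp(L)` occurs for `p = 4`, `21/32·ulp(L)` for
`p = 2`, in the model quoted below), so `L` need not be `fl (Σ h)` — which is why ROUND-EXPANSION
has to look at `r` (and at the sign of what lies below it).

The condition is the trace of how `L` is produced.  In the second (smallest-first) traversal of
COMPRESS the carry `Q` meets the next component `g` of the first traversal (a float `≥ 2^(emin+p)`
with `|Q| ≤ ulp g`) and becomes `Qₙ = fl (g + Q)`:
* EMITTING STEP (`q = g + Q − Qₙ ≠ 0` is emitted and becomes the new `r`): `q` is a round-to-nearest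
  error, so `|q| ≤ ulp(Qₙ)/2`; and if `|Qₙ| = 2^j ≥ 2^(emin+p)` with `|g + Q| < 2^j`, then `g + Q`
  lies in the binade below `2^j`, whose ulp is `ulp(Qₙ)/2`, so `|q| ≤ ulp(Qₙ)/4`
  (`roundoff_near_fl`, a fact about a single rounding);
* EXACT STEP (`q = 0`, the carry becomes `g + Q` exactly and `r` is unchanged): `|Q| ≤ |g + Q|`, so
  the first clause persists; for the second, `|Q| < |g + Q| = 2^j` already gives
  `ulp Q ≤ 2^(j−p) = ulp(g + Q)/2`, and `|Q| = |g + Q|` would mean `g = −2Q`, `ulp g ≤ |Q|`, while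
  `r` (pointing towards zero from `−Q`) points AWAY from zero from `Q` and dominates the older
  components — contradicting the "stair" `|Q + Σ(emitted)| < ulp g` left by the first traversal
  (a configuration compatible with `|Q| ≤ ulp g` only when `p = 2`).
The induction is carried along Theorem 23's own invariant `UpInv` and the hypotheses of
`compressUp_spec` (`Literature/ComputerArithmetic/Shewchuk1997/Compress.lean`), exactly as in
`CompressTopFaithful.lean`.

HONEST FRAMING.  New work of this project, not the formalisation of a published theorem;
Shewchuk's paper stops at COMPRESS and APPROXIMATE [cite: Shewchuk1997, §2.7–2.8].  Evidence
gathered before the proof (exhaustive integer model of COMPRESS over all nonoverlapping inputs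
with `p`-bit components below `2^E`, signs free, zeros allowed): see the docstring of
`compress_penultimate_near` for the counts; no violation of either clause was found, and the first
clause is attained (`|r| = ulp(L)/2`).  Reference: J. R. Shewchuk, Discrete Comput. Geom. 18 (1997)
305–363, §2.7, Theorem 23 [Shewchuk1997]; ulp and roundings as in Boldo–Jeannerod–Melquiond–Muller,
ACM Comput. Surv. 55 (2023), §2.1, §2.6 [BoldoEtAl2023].
-/

namespace Summit.Ventures.CertifiedArithmetic.Expansions

open Literature.ComputerArithmetic.JeannerodRump2018
open Literature.ComputerArithmetic.BoldoJeannerodMelquiondMuller2023 hiding twoSum twoSum_fst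
open Literature.ComputerArithmetic.JoldesMullerPopescu2017 (ulp_le_of_abs_lt_two_zpow)
open Literature.ComputerArithmetic.GraillatMuller2025 (ulp_two_zpow)
open Literature.ComputerArithmetic.Shewchuk1997

variable {p : ℕ} {emin : ℤ} {fl : ℚ → ℚ}

/-! ### One rounding -/

/-- **THE ROUNDOFF CONDITION OF A SINGLE ROUNDING.**  A round-to-nearest error `t − fl t` is at
most `ulp(fl t)/2`; and at most `ulp(fl t)/4` when `|fl t| = 2^j` is a power of two with
`j ≥ emin + p` approached from below (`|t| < |fl t|`): then `t` lies in the binade below `2^j`,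
whose ulp is `2^(j−p) = ulp(fl t)/2`. [cite: BoldoEtAl2023, §2.6 Property 2.7 (consequence)] -/
theorem roundoff_near_fl (hp : 1 ≤ p) (hfl : IsRoundNearest p emin fl) (t : ℚ) :
    |t - fl t| ≤ ulp p emin (fl t) / 2 ∧
      ((∃ j : ℤ, emin + p ≤ j ∧ |fl t| = 2 ^ j) → |t| < |fl t| →
        |t - fl t| ≤ ulp p emin (fl t) / 4) := by
  refine ⟨abs_sub_fl_le_half_ulp_fl hp hfl t, ?_⟩
  rintro ⟨j, hj, hpow⟩ hlt
  have hE : emin ≤ j - p + 1 := by omega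
  have hut : ulp p emin t ≤ (2 : ℚ) ^ (j - p) :=
    ulp_le_of_abs_lt_two_zpow (by rw [← hpow]; exact hlt) (by omega)
  have huf : ulp p emin (fl t) = 2 * (2 : ℚ) ^ (j - p) := by
    rw [← ulp_abs, hpow, ulp_two_zpow hE, show j - p + 1 = (j - p) + 1 by ring,
      zpow_add_one₀ (by norm_num : (2 : ℚ) ≠ 0), mul_comm]
  have := abs_sub_fl_le_half_ulp hp hfl t
  rw [huf]; linarith

/-! ### The exact step of the second traversal -/

/-- In a list of NONZERO floats each lying 1-below the ones before it, the tail sums to less than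
the head in magnitude. -/
private theorem abs_sum_tail_lt {r : ℚ} {tail : List ℚ} (hF : ∀ h ∈ r :: tail, IsFloat p emin h)
    (hpw : (r :: tail).Pairwise (fun a b => Below 1 b a)) (hne : ∀ h ∈ r :: tail, h ≠ 0) :
    |tail.sum| < |r| := by
  have hr0 : r ≠ 0 := hne r (by simp)
  cases tail with
  | nil => simpa using abs_pos.mpr hr0
  | cons r' tl =>
    obtain ⟨hbr, hpw'⟩ := List.pairwise_cons.mp hpw
    have hr'0 : r' ≠ 0 := hne r' (by simp)
    obtain ⟨s, -, hsr, hr's⟩ := (hbr r' (by simp)).normalize (hF r (by simp))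
    rw [one_mul] at hr's
    have hle : ∀ h ∈ r' :: tl, |h| ≤ |r'| := by
      intro h hh
      rcases List.mem_cons.mp hh with rfl | hh
      · exact le_rfl
      · exact (((List.pairwise_cons.mp hpw').1 h hh).abs_lt le_rfl hr'0).le
    have hexp : IsExpansion 1 (r' :: tl).reverse := List.pairwise_reverse.mpr hpw'
    exact (abs_sum_lt_two_zpow_of_rev (fun h hh => hF h (List.mem_cons_of_mem _ hh)) hexp
      (fun h hh => (hle h hh).trans_lt hr's)).trans_le (hsr.two_zpow_le_abs hr0)

/-- THE EXACT STEP.  State `(rs, Q)` of the second traversal as in Theorem 23's invariant (the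
emitted components `rs`, most recent first, are nonzero floats each lying 1-below the more
recent ones; `Q ≠ 0`), next component `g ≠ 0` absorbed exactly (new carry `g + Q` with
`|Q| ≤ |g + Q|`), and the stair `|Q + Σ rs| < ulp g` left by the first traversal: the roundoff
condition passes from `(Q, r)` to `(g + Q, r)` for the most recent component `r`. -/
private theorem absorb_near (hp : 2 ≤ p) {Q g r : ℚ} {rs : List ℚ} (hr : r ∈ rs.head?)
    (hF : ∀ h ∈ rs, IsFloat p emin h) (hpw : rs.Pairwise (fun a b => Below 1 b a))
    (hne : ∀ h ∈ rs, h ≠ 0) (hQ0 : Q ≠ 0) (hg0 : g ≠ 0)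
    (hstg : |Q + rs.sum| < ulp p emin g) (hQn_ge : |Q| ≤ |g + Q|)
    (hprev : |r| ≤ ulp p emin Q / 2) :
    |r| ≤ ulp p emin (g + Q) / 2 ∧
      ((∃ j : ℤ, emin + p ≤ j ∧ |g + Q| = 2 ^ j) → |g + Q + r| < |g + Q| →
        |r| ≤ ulp p emin (g + Q) / 4) := by
  obtain ⟨tail, rfl⟩ : ∃ tail, rs = r :: tail := by
    cases rs with
    | nil => simp at hr
    | cons a tl =>
      have : a = r := by simpa using hr
      exact ⟨tl, by rw [this]⟩
  refine ⟨hprev.trans (by linarith [ulp_mono (p := p) (emin := emin) hQn_ge]), ?_⟩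
  rintro ⟨j, hj, hpow⟩ htoward
  have h2 : (0 : ℚ) < 2 := by norm_num
  rcases hQn_ge.lt_or_eq with hlt | heq
  · -- the old carry lies below the binade of the new one: `ulp Q ≤ 2^(j-p) = ulp(g+Q)/2`
    have hE : emin ≤ j - p + 1 := by omega
    have huQ : ulp p emin Q ≤ (2 : ℚ) ^ (j - p) :=
      ulp_le_of_abs_lt_two_zpow (by rw [← hpow]; exact hlt) (by omega)
    have hun : ulp p emin (g + Q) = 2 * (2 : ℚ) ^ (j - p) := by
      rw [← ulp_abs, hpow, ulp_two_zpow hE, show j - p + 1 = (j - p) + 1 by ring,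
        zpow_add_one₀ h2.ne', mul_comm]
    rw [hun]; linarith
  · -- `|Q| = |g + Q|`: then `g = -2Q`, `ulp g ≤ |Q|`, and the stair is violated
    exfalso
    have hgQ : g + Q = -Q := by
      rcases abs_eq_abs.mp heq.symm with h | h
      · exact absurd (by linarith : g = 0) hg0
      · exact h
    have hQabs : |Q| = (2 : ℚ) ^ j := heq.trans hpow
    have hgabs : |g| = (2 : ℚ) ^ (j + 1) := by
      rw [show g = -(2 * Q) by linarith, abs_neg, abs_mul, abs_two, hQabs,
        zpow_add_one₀ h2.ne', mul_comm]
    have hulpg : ulp p emin g ≤ |Q| := by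
      have hE : emin ≤ (j + 1) - p + 1 := by omega
      rw [← ulp_abs, hgabs, ulp_two_zpow hE, hQabs]
      exact zpow_le_zpow_right₀ (by norm_num) (by omega)
    -- `r` points towards zero from `g + Q = -Q`, i.e. AWAY from zero from `Q`
    rw [hgQ, abs_neg] at htoward
    have key : |Q + r| = |Q| + |r| := by
      rcases lt_or_gt_of_ne hQ0 with hQneg | hQpos
      · have hrle : r ≤ 0 := by
          by_contra hrpos
          rw [not_le] at hrpos
          rw [abs_of_pos (by linarith : 0 < -Q + r), abs_of_neg hQneg] at htoward
          linarith
        rw [abs_of_neg hQneg, abs_of_nonpos hrle, abs_of_nonpos (by linarith)]; ring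
      · have hrge : 0 ≤ r := by
          by_contra hrneg
          rw [not_le] at hrneg
          rw [abs_of_neg (by linarith : -Q + r < 0), abs_of_pos hQpos] at htoward
          linarith
        rw [abs_of_pos hQpos, abs_of_nonneg hrge, abs_of_nonneg (by linarith)]
    have htail : |tail.sum| < |r| := abs_sum_tail_lt hF hpw hne
    have h1 := abs_add_le (Q + (r + tail.sum)) (-tail.sum)
    rw [abs_neg, show Q + (r + tail.sum) + -tail.sum = Q + r by ring] at h1
    rw [List.sum_cons] at hstg
    linarith

/-! ### The second traversal -/

/-- THE SECOND TRAVERSAL (Lines 10–16 of COMPRESS) run from a state satisfying Theorem 23's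
invariant `UpInv` and the roundoff condition for (carry, most recent component), over remaining
components obeying the hypotheses of `compressUp_spec`, ends with a list whose last two
components satisfy the roundoff condition. -/
private theorem compressUp_penultimate_near (hp : 2 ≤ p) (hfl : IsRoundNearest p emin fl) :
    ∀ (gs : List ℚ) (Q : ℚ) (rs : List ℚ), UpInv p emin 1 rs Q →
      (∀ r ∈ rs.head?, |r| ≤ ulp p emin Q / 2 ∧
        ((∃ j : ℤ, emin + p ≤ j ∧ |Q| = 2 ^ j) → |Q + r| < |Q| → |r| ≤ ulp p emin Q / 4)) →
      (∀ g ∈ gs, IsFloat p emin g) → (∀ g ∈ gs, (2 : ℚ) ^ (emin + p) ≤ |g|) →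
      UStair p emin (Q + rs.sum) gs → gs.IsChain (fun a b => |a| ≤ ulp p emin b) →
      (∀ g ∈ gs.head?, |Q| ≤ ulp p emin g) →
      ∀ L r t, (rs.reverse ++ compressUp fl Q gs).reverse = L :: r :: t →
        |r| ≤ ulp p emin L / 2 ∧
          ((∃ j : ℤ, emin + p ≤ j ∧ |L| = 2 ^ j) → |L + r| < |L| → |r| ≤ ulp p emin L / 4) := by
  have hp1 : 1 ≤ p := le_trans (by norm_num) hp
  have hflc : RoundoffBelow 1 fl := roundoffBelow_one hp1 hfl
  intro gs
  induction gs with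
  | nil =>
    intro Q rs _ hP _ _ _ _ _ L r t hL
    rw [compressUp_nil, List.reverse_append, List.reverse_singleton, List.reverse_reverse,
      List.singleton_append] at hL
    obtain ⟨hQL, hrs⟩ := List.cons_eq_cons.mp hL
    subst hQL
    subst hrs
    exact hP r (by simp)
  | cons g rest ih =>
    intro Q rs inv hP hF hbig hst hch hQg L r t hL
    have hg : IsFloat p emin g := hF g (by simp)
    have hgbig : (2 : ℚ) ^ (emin + p) ≤ |g| := hbig g (by simp)
    have hQg' : |Q| ≤ ulp p emin g := hQg g (by simp)
    have hF' : ∀ x ∈ rest, IsFloat p emin x := fun x hx => hF x (List.mem_cons_of_mem _ hx)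
    have hbig' : ∀ x ∈ rest, (2 : ℚ) ^ (emin + p) ≤ |x| :=
      fun x hx => hbig x (List.mem_cons_of_mem _ hx)
    obtain ⟨hstg, hst'⟩ := uStair_cons.mp hst
    obtain ⟨hgU, hch'⟩ := List.isChain_cons.mp hch
    have hg0 : g ≠ 0 := by
      intro h; rw [h, abs_zero] at hgbig
      exact absurd hgbig (not_le.mpr (zpow_pos (by norm_num) _))
    have hulpg : ulp p emin g ≤ |g| := ulp_le_abs_of_isFloat hg hg0
    have hQleg : |Q| ≤ |g| := hQg'.trans hulpg
    obtain ⟨h1, -, h2, h4⟩ := fastTwoSum_exact hp1 hfl hg inv.hQ hQleg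
    by_cases hq : (fastTwoSum fl g Q).2 = 0
    · -- exact step
      obtain ⟨inv', hQnval, hQn_ge⟩ := inv.absorb hp hfl hg hgbig hQg' hq
      rw [compressUp_cons_of_eq_zero hq] at hL
      generalize hQn : (fastTwoSum fl g Q).1 = Qn at *
      have hS : Qn + rs.sum = Q + rs.sum + g := by rw [hQnval]; ring
      have hQg_next : ∀ y ∈ rest.head?, |Qn| ≤ ulp p emin y := by
        intro y hy
        have hgy : |g| ≤ ulp p emin y := hgU y hy
        have hT : |Qn + rs.sum| < ulp p emin y := by rw [hS]; exact hst'.head_lt hy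
        obtain ⟨u, -, hU⟩ := exists_ulp_eq_two_zpow (p := p) (emin := emin) y
        obtain ⟨k, -, hK⟩ := exists_ulp_eq_two_zpow (p := p) (emin := emin) Q
        have hkQ : OnGrid k Q := by
          obtain ⟨K, hK'⟩ := exists_eq_int_mul_ulp_of_isFloat (p := p) (emin := emin) inv.hQ
          exact ⟨K, by rw [← hK]; exact hK'⟩
        have hkg : OnGrid k g := onGrid_of_two_zpow_le_ulp hg (by rw [← hK]; exact ulp_mono hQleg)
        have hkQn : OnGrid k Qn := by rw [hQnval]; exact hkg.add hkQ
        have hku : k ≤ u := by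
          have : (2 : ℚ) ^ k ≤ (2 : ℚ) ^ u := by
            rw [← hK, ← hU]; exact (ulp_mono hQleg).trans (hulpg.trans hgy)
          exact (zpow_le_zpow_iff_right₀ (by norm_num : (1 : ℚ) < 2)).mp this
        have hr : |rs.sum| < (2 : ℚ) ^ k := by rw [← hK]; exact inv.sum_lt
        rw [hU]
        exact abs_le_two_zpow_of_onGrid hku hkQn hr (by rw [← hU]; exact hT)
      have hP' : ∀ r' ∈ rs.head?, |r'| ≤ ulp p emin Qn / 2 ∧
          ((∃ j : ℤ, emin + p ≤ j ∧ |Qn| = 2 ^ j) → |Qn + r'| < |Qn| →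
            |r'| ≤ ulp p emin Qn / 4) := by
        intro r' hr'
        rw [hQnval]
        exact absorb_near hp hr' inv.floats inv.pw inv.ne (inv.hd r' hr').2 hg0 hstg
          (by rw [← hQnval]; exact hQn_ge) (hP r' hr').1
      exact ih Qn rs inv' hP' hF' hbig' (by rw [hS]; exact hst') hch' hQg_next L r t hL
    · -- emitting step
      obtain ⟨inv', hbound⟩ := inv.emit hp hfl le_rfl hflc hg hgbig hQg' hq
      rw [compressUp_cons_of_ne_zero hq] at hL
      generalize hQn : (fastTwoSum fl g Q).1 = Qn at *
      generalize hqn : (fastTwoSum fl g Q).2 = q at *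
      have hS : Qn + (q :: rs).sum = Q + rs.sum + g := by rw [List.sum_cons]; linarith [h4]
      have hQg_next : ∀ y ∈ rest.head?, |Qn| ≤ ulp p emin y := by
        intro y hy
        have hgy : |g| ≤ ulp p emin y := hgU y hy
        have hT : |Qn + (q :: rs).sum| < ulp p emin y := by rw [hS]; exact hst'.head_lt hy
        obtain ⟨u, hu, hU⟩ := exists_ulp_eq_two_zpow (p := p) (emin := emin) y
        obtain ⟨k, -, hK⟩ := exists_ulp_eq_two_zpow (p := p) (emin := emin) (g + Q)
        have hkQn : OnGrid k Qn := by
          obtain ⟨K, hK'⟩ := exists_fl_eq_int_mul_ulp hp1 hfl (g + Q)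
          exact ⟨K, by rw [h1, hK', hK]⟩
        have hku : k ≤ u := by
          have ht2 : |g + Q| ≤ 2 * (2 : ℚ) ^ u :=
            calc |g + Q| ≤ |g| + |Q| := abs_add_le _ _
              _ ≤ |g| + |g| := by linarith
              _ ≤ 2 * (2 : ℚ) ^ u := by rw [← hU]; linarith
          have := ulp_le_two_zpow_of_abs_le hp hu ht2
          rw [hK] at this
          exact (zpow_le_zpow_iff_right₀ (by norm_num : (1 : ℚ) < 2)).mp this
        have hr : |(q :: rs).sum| < (2 : ℚ) ^ k := by rw [← hK, List.sum_cons]; exact hbound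
        rw [hU]
        exact abs_le_two_zpow_of_onGrid hku hkQn hr (by rw [← hU]; exact hT)
      have hP' : ∀ r' ∈ (q :: rs).head?, |r'| ≤ ulp p emin Qn / 2 ∧
          ((∃ j : ℤ, emin + p ≤ j ∧ |Qn| = 2 ^ j) → |Qn + r'| < |Qn| →
            |r'| ≤ ulp p emin Qn / 4) := by
        intro r' hr'
        have : q = r' := by simpa using hr'
        subst this
        rw [h4, h2, h1]
        exact roundoff_near_fl hp1 hfl (g + Q)
      have hlist : rs.reverse ++ q :: compressUp fl Qn rest =
          (q :: rs).reverse ++ compressUp fl Qn rest := by simp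
      rw [hlist] at hL
      exact ih Qn (q :: rs) inv' hP' hF' hbig' (by rw [hS]; exact hst') hch' hQg_next L r t hL

/-! ### The theorem -/

/-- **THE LAST TWO COMPONENTS OF COMPRESS SATISFY THE ROUNDOFF CONDITION** (`p ≥ 2`, ANY
round-to-nearest, every nonoverlapping expansion of floats): if `compress fl e` read from the top
is `L, r, …` then `|r| ≤ ulp(L)/2`, and `|r| ≤ ulp(L)/4` whenever `|L| = 2^j` (`j ≥ emin + p`) is a
power of two and `|L + r| < |L|` — the hypothesis `hnear` of `roundExpansion_eq_fl_sum`.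

Evidence gathered before the proof (exhaustive integer model of the tree's `compress` under
round-to-nearest, ties-to-even / ties-away, over ALL inputs `e` with `IsExpansion 1 e`, components
floats of precision `p` below `2^(emin+E)`, signs free, zeros and subnormals allowed, length `≤ n`;
both clauses checked on every output with at least two components):
`p = 2, E = 7, n = 6`: 103 052 inputs, 96 536 such outputs, 0 violations, `|r| = ulp(L)/2` attained
11 646 / 10 002 times, premises of the second clause met 26 668 / 25 024 times;
`p = 3, E = 8, n = 6`: 470 776 inputs, 442 280 outputs, 0 violations (attained 41 462 / 35 714;
second clause exercised 56 144 / 54 228 times);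
`p = 4, E = 9, n = 6`: 1 726 576 inputs, 1 622 816 outputs, 0 violations (attained 101 920 / 90 846;
second clause exercised 101 034 / 99 452 times). -/
theorem compress_penultimate_near (hp : 2 ≤ p) (hfl : IsRoundNearest p emin fl) {e : List ℚ}
    (he : ∀ x ∈ e, IsFloat p emin x) (hexp : IsExpansion 1 e) :
    ∀ L r t, (compress fl e).reverse = L :: r :: t →
      |r| ≤ ulp p emin L / 2 ∧
        ((∃ j : ℤ, emin + p ≤ j ∧ |L| = 2 ^ j) → |L + r| < |L| → |r| ≤ ulp p emin L / 4) := by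
  cases hrev : e.reverse with
  | nil =>
    have he0 : e = [] := by simpa using congrArg List.reverse hrev
    subst he0; simp [compress]
  | cons em rest =>
    have he' : e = rest.reverse ++ [em] := by simpa using congrArg List.reverse hrev
    have hcomp : compress fl e =
        compressUp fl (compressDown fl em rest).2 (compressDown fl em rest).1.reverse := by
      simp only [compress, hrev]
    rw [hcomp]
    subst he'
    have hem : IsFloat p emin em := he em (by simp)
    have hrestF : ∀ y ∈ rest, IsFloat p emin y := fun y hy => he y (by simp [hy])
    have hexp' : IsExpansion 1 rest.reverse := hexp.sublist (List.sublist_append_left _ _)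
    have hbel : ∀ y ∈ rest, Below 1 y em := fun y hy =>
      (List.pairwise_append.mp hexp).2.2 y (List.mem_reverse.mpr hy) em (by simp)
    have outd := compressDown_spec hp hfl rest em hem hrestF hexp' hbel
    generalize (compressDown fl em rest).1 = gs at *
    generalize (compressDown fl em rest).2 = gb at *
    have inv : UpInv p emin 1 [] gb :=
      ⟨by simp, outd.hgb, List.Pairwise.nil, by simp, by simp, by simpa using ulp_pos _⟩
    have hst : UStair p emin (gb + ([] : List ℚ).sum) gs.reverse := by
      have h := uStair_reverse_of_dStair outd.stair
      rw [List.reverse_append, List.reverse_singleton, List.singleton_append, uStair_cons,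
        zero_add] at h
      simpa using h.2
    have hch0 := List.isChain_reverse.mpr outd.chain
    rw [List.reverse_append, List.reverse_singleton, List.singleton_append,
      List.isChain_cons] at hch0
    intro L r t hL
    exact compressUp_penultimate_near hp hfl gs.reverse gb [] inv (by simp)
      (fun g hg => outd.floats g (List.mem_reverse.mp hg))
      (fun g hg => outd.big g (List.mem_reverse.mp hg)) hst hch0.2 hch0.1 L r t
      (by simpa using hL)

/-- The same, addressed by position: for `h = compress fl e` with `n ≥ 2` components,
`L = h[n-1]` and `r = h[n-2]`. -/
theorem compress_penultimate_near' (hp : 2 ≤ p) (hfl : IsRoundNearest p emin fl) {e : List ℚ}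
    (he : ∀ x ∈ e, IsFloat p emin x) (hexp : IsExpansion 1 e) {init : List ℚ} {r L : ℚ}
    (hsplit : compress fl e = init ++ [r, L]) :
    |r| ≤ ulp p emin L / 2 ∧
      ((∃ j : ℤ, emin + p ≤ j ∧ |L| = 2 ^ j) → |L + r| < |L| → |r| ≤ ulp p emin L / 4) :=
  compress_penultimate_near hp hfl he hexp L r init.reverse (by simp [hsplit])

/-- **FIRST CLAUSE ALONE**: the component below the top of `COMPRESS(e)` is at most half an ulp of
the top — so the top two components form a "double-word" pair in the sense of
[cite: BoldoEtAl2023, §1.6 (double-word numbers: `|x_l| ≤ ½ulp(x_h)`)], for any tie rule. -/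
theorem abs_compress_penultimate_le_half_ulp (hp : 2 ≤ p) (hfl : IsRoundNearest p emin fl)
    {e : List ℚ} (he : ∀ x ∈ e, IsFloat p emin x) (hexp : IsExpansion 1 e) :
    ∀ L r t, (compress fl e).reverse = L :: r :: t → |r| ≤ ulp p emin L / 2 :=
  fun L r t hL => (compress_penultimate_near hp hfl he hexp L r t hL).1

end Summit.Ventures.CertifiedArithmetic.Expansions
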